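import Mathlib
import Summits.Ventures.PercRepro2.SwOutJunctions
import Summits.Ventures.PercRepro2.SwOutJunctionAsym

/-!
# The multi-junction theorem on the asymmetric side (blind cell PercRepro2, night-4 g30,
2026-08-28; proofs/NIGHT4-G30.md §7)

g11's multi-junction theorem (`rigidOK_of_junctions`: an INDEPENDENT set `J` of junctions, each
with every neighbour `p ≠ h` adjacent to `h`, every other vertex of the region with an outside
edge or no edge) enters the conditioning `Q` through the mark's exemption and through the
transport of `Q` to the graph split at the MATCHED junctions on the fine configurations
(`mem_tgtU_splitS_of_mem`, `mem_tgtU_of_mem_splitS`).  On the asymmetric side `T(𝓤₁, 𝓤₂)` the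
exemption goes to the vertices forced by `𝓤₁` (predicate `F`) and the up-sets pull back along
`Sum.inl` (`pullInl`): the clusters of `l` in the split graph, read on `inl`, are the clusters of
`l` (`mem_tgtU2_splitS_of_mem`, `mem_tgtU2_of_mem_splitS`).  The rest is g11's proof verbatim with
`card_orbit_le2`: **`rigidOK2_of_junctions`** (every class), **`swAll2_of_junctions`** (the whole
graph: the asymmetric domination on every graph with an independent set of junctions in the
region `{l}ᶜ`, for every pair of up-sets — g11's class B2 of the census model).
-/

namespace Summit.Ventures.PercRepro2

namespace LocRows

open Hull

variable {V : Type*} {E : Type*} [Fintype E] [DecidableEq E]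

open scoped Classical

variable {ends : E → Sym2 V} {U : Set V} {ξ : Config E} {l h : V} {J : Set V}
  {𝓤₁ 𝓤₂ : Set (Set V)}

section PullS

variable {S : Set V}

omit [Fintype E] [DecidableEq E] in
/-- On an `S`-fine configuration whose red cluster of `l` avoids `h`, the red cluster of `l` in
the split graph, read on `inl`, is the red cluster of `l` (`l ∉ S`). -/
lemma setOf_inl_mem_cluster_splitS (hind : IndepSet ends S) (hlS : l ∉ S) {η : Config E}
    (hf : MFine ends S h η) (hhl : Sum.inl h ∉ cluster (splitEndsS ends S) η (Sum.inl l)) :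
    {x | Sum.inl x ∈ cluster (splitEndsS ends S) η (Sum.inl l)} = cluster ends η l :=
  Set.Subset.antisymm (fun _ hx => conn_of_conn_splitS_inl hind hx)
    (cluster_l_subset_splitS_of_mfine hind hlS hf hhl)

/-- **The asymmetric side passes to the split** on `S`-fine configurations (`l ∉ S`). -/
theorem mem_tgtU2_splitS_of_mem (hind : IndepSet ends S) (hlS : l ∉ S) {η : Config E}
    (hf : MFine ends S h η) (hQ : η ∈ tgtU2 ends l h 𝓤₁ 𝓤₂) :
    η ∈ tgtU2 (splitEndsS ends S) (Sum.inl l) (Sum.inl h) (pullInl E 𝓤₁) (pullInl E 𝓤₂) := by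
  rw [mem_tgtU2] at hQ ⊢
  obtain ⟨hhl, hA, hB⟩ := hQ
  have hhA' : Sum.inl h ∉ cluster (splitEndsS ends S) η (Sum.inl l) :=
    fun h' => hhl (Or.inl (conn_of_conn_splitS_inl hind h'))
  have hhB' : Sum.inl h ∉ cluster (splitEndsS ends S) (blue η) (Sum.inl l) :=
    fun h' => hhl (Or.inr (conn_of_conn_splitS_inl hind h'))
  refine ⟨?_, ?_, ?_⟩
  · rintro (h1 | h1)
    · exact hhA' h1
    · exact hhB' h1
  · show {x | Sum.inl x ∈ cluster (splitEndsS ends S) η (Sum.inl l)} ∈ 𝓤₁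
    rw [setOf_inl_mem_cluster_splitS hind hlS hf hhA']
    exact hA
  · show {x | Sum.inl x ∈ cluster (splitEndsS ends S) (blue η) (Sum.inl l)} ∉ 𝓤₂
    rw [setOf_inl_mem_cluster_splitS hind hlS (mfine_blue_iff.2 hf) hhB']
    exact hB

/-- **The asymmetric side comes back from the split** on `S`-fine configurations (`l ∉ S`). -/
theorem mem_tgtU2_of_mem_splitS (hind : IndepSet ends S) (hlS : l ∉ S) {η : Config E}
    (hf : MFine ends S h η)
    (hQ : η ∈ tgtU2 (splitEndsS ends S) (Sum.inl l) (Sum.inl h) (pullInl E 𝓤₁) (pullInl E 𝓤₂)) :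
    η ∈ tgtU2 ends l h 𝓤₁ 𝓤₂ := by
  rw [mem_tgtU2] at hQ ⊢
  obtain ⟨hhl, hA, hB⟩ := hQ
  have hhA' : Sum.inl h ∉ cluster (splitEndsS ends S) η (Sum.inl l) := fun h' => hhl (Or.inl h')
  have hhB' : Sum.inl h ∉ cluster (splitEndsS ends S) (blue η) (Sum.inl l) :=
    fun h' => hhl (Or.inr h')
  have eA := setOf_inl_mem_cluster_splitS hind hlS hf hhA'
  have eB := setOf_inl_mem_cluster_splitS hind hlS (mfine_blue_iff.2 hf) hhB'
  refine ⟨?_, ?_, ?_⟩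
  · rintro (h1 | h1)
    · rw [← eA] at h1
      exact hhA' h1
    · rw [← eB] at h1
      exact hhB' h1
  · rw [← eA]
    exact hA
  · rw [← eB]
    exact hB

end PullS

/-! ## Cores at the junctions only -/

section Core

variable {F : V → Prop}

/-- Every core of a `T`-configuration is `h` or a junction. -/
theorem core_mem_J_of_out2 (hF : ∀ x, F x → ∀ S ∈ 𝓤₁, x ∈ S)
    (hout : ∀ x ∈ U, x ≠ h → x ∉ J →
      F x ∨ (∃ e y, ends e = s(x, y) ∧ y ∉ U) ∨ (∀ e, x ∉ ends e))
    {ζ : Config E} (hζ : ζ ∈ swOutSide2 ends l h 𝓤₁ 𝓤₂ U ξ) {x : V}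
    (hxT : x ∈ cluster ends ζ h) (hxTp : x ∈ cluster ends (blue ζ) h) : x = h ∨ x ∈ J := by
  by_cases hxh : x = h
  · exact Or.inl hxh
  by_cases hxJ : x ∈ J
  · exact Or.inr hxJ
  exfalso
  have hQ := (mem_swOutSide2.1 hζ).1
  have hcl := (mem_swOutSide2.1 hζ).2
  rw [mem_tgtU2] at hQ
  obtain ⟨hhl, hA, _⟩ := hQ
  have hhA : h ∉ cluster ends ζ l := fun h' => hhl (Or.inl h')
  have hxU : x ∈ U := (mem_outClass.1 hcl).2 (Or.inl hxT)
  rcases hout x hxU hxh hxJ with hf | ⟨e, y, hxy, hyU⟩ | hiso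
  · exact hhA (conn_trans (hF x hf _ hA) (conn_symm hxT))
  · cases he : ζ e with
    | true => exact hyU ((mem_outClass.1 hcl).2 (Or.inl (mem_cluster_of_edge hxT he hxy)))
    | false =>
      have he' : blue ζ e = true := by rw [blue_eq_true_iff]; exact he
      exact hyU ((mem_outClass.1 hcl).2 (Or.inr (mem_cluster_of_edge hxTp he' hxy)))
  · obtain ⟨e, hxe⟩ := exists_edge_of_mem_cluster hxT hxh
    exact hiso e hxe

/-- Every core of a `T`-configuration is `h` or a MATCHED junction. -/
theorem core_mem_matchedSet2 (hF : ∀ x, F x → ∀ S ∈ 𝓤₁, x ∈ S)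
    (hout : ∀ x ∈ U, x ≠ h → x ∉ J →
      F x ∨ (∃ e y, ends e = s(x, y) ∧ y ∉ U) ∨ (∀ e, x ∉ ends e))
    {ζ : Config E} (hζ : ζ ∈ swOutSide2 ends l h 𝓤₁ 𝓤₂ U ξ) {x : V}
    (hxT : x ∈ cluster ends ζ h) (hxTp : x ∈ cluster ends (blue ζ) h) :
    x = h ∨ x ∈ matchedSet ends J h ζ := by
  rcases core_mem_J_of_out2 hF hout hζ hxT hxTp with h1 | h1
  · exact Or.inl h1
  · exact Or.inr ⟨h1, matched_of_core hxT hxTp⟩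

/-- A `T`-configuration is fine for its matched set. -/
theorem mfine_matchedSet2 (hF : ∀ x, F x → ∀ S ∈ 𝓤₁, x ∈ S) (hhJ : h ∉ J) (hind : IndepSet ends J)
    (hadj : ∀ u ∈ J, ∀ e (he : u ∈ ends e), Sym2.Mem.other he ≠ h →
      ∃ e', ends e' = s(Sym2.Mem.other he, h))
    (hout : ∀ x ∈ U, x ≠ h → x ∉ J →
      F x ∨ (∃ e y, ends e = s(x, y) ∧ y ∉ U) ∨ (∀ e, x ∉ ends e))
    {ζ : Config E} (hζ : ζ ∈ swOutSide2 ends l h 𝓤₁ 𝓤₂ U ξ) :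
    MFine ends (matchedSet ends J h ζ) h ζ :=
  mfine_of_matched (indepSet_mono (matchedSet_subset (ends := ends) (h := h) ζ) hind)
    (fun h' => hhJ h'.1) (fun u hu => hadj u hu.1)
    (fun _ hx hx' => core_mem_matchedSet2 hF hout hζ hx hx') (fun _ hu => hu.2)

/-- A `T`-configuration is core-free in the graph split at its matched set. -/
theorem coreFree_split_matchedSet2 (hF : ∀ x, F x → ∀ S ∈ 𝓤₁, x ∈ S) (hhJ : h ∉ J)
    (hind : IndepSet ends J)
    (hout : ∀ x ∈ U, x ≠ h → x ∉ J →
      F x ∨ (∃ e y, ends e = s(x, y) ∧ y ∉ U) ∨ (∀ e, x ∉ ends e))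
    {ζ : Config E} (hζ : ζ ∈ swOutSide2 ends l h 𝓤₁ 𝓤₂ U ξ) :
    CoreFree (splitEndsS ends (matchedSet ends J h ζ)) ζ (Sum.inl h) := by
  have hind' : IndepSet ends (matchedSet ends J h ζ) :=
    indepSet_mono (matchedSet_subset (ends := ends) (h := h) ζ) hind
  rintro (x | e) hxT hxTp
  · have h1 : x ∈ cluster ends ζ h := conn_of_conn_splitS_inl hind' hxT
    have h2 : x ∈ cluster ends (blue ζ) h := conn_of_conn_splitS_inl hind' hxTp
    rcases core_mem_matchedSet2 hF hout hζ h1 h2 with rfl | hxM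
    · rfl
    · exact absurd hxT (inl_S_notMem_cluster_splitS hxM (fun h' => hhJ (h' ▸ hxM.1)))
  · exfalso
    obtain ⟨_, _, _, h1, _⟩ := conn_of_conn_splitS_inr hind' hxT
    obtain ⟨_, _, _, h2, _⟩ := conn_of_conn_splitS_inr hind' hxTp
    rw [blue_eq_true_iff] at h2
    rw [h1] at h2
    exact absurd h2 (by simp)

end Core

/-! ## The matched set along the orbit -/

section Orbit

variable {F : V → Prop} (hF : ∀ x, F x → ∀ S ∈ 𝓤₁, x ∈ S) (hhJ : h ∉ J) (hind : IndepSet ends J)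
  (hadj : ∀ u ∈ J, ∀ e (he : u ∈ ends e), Sym2.Mem.other he ≠ h →
    ∃ e', ends e' = s(Sym2.Mem.other he, h))
  (hout : ∀ x ∈ U, x ≠ h → x ∉ J →
    F x ∨ (∃ e y, ends e = s(x, y) ∧ y ∉ U) ∨ (∀ e, x ∉ ends e))

include hF hhJ hind hadj hout in
/-- A junction outside the matched set of `ζ₁` is unmatched in every configuration obtained
from `ζ₁` by arm flips of the graph split at that matched set (and fine for it). -/
lemma not_matched_of_flips2 {ζ₁ : Config E} (hζ₁ : ζ₁ ∈ swOutSide2 ends l h 𝓤₁ 𝓤₂ U ξ) {u : V}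
    (huJ : u ∈ J) (huM : u ∉ matchedSet ends J h ζ₁) {η : Config E}
    (hf : MFine ends (matchedSet ends J h ζ₁) h η)
    (hm : Matched (splitEndsS ends (matchedSet ends J h ζ₁)) (Sum.inl u) (Sum.inl h) η →
      Matched (splitEndsS ends (matchedSet ends J h ζ₁)) (Sum.inl u) (Sum.inl h) ζ₁) :
    ¬ Matched ends u h η := by
  intro hmη
  have hind' : IndepSet ends (matchedSet ends J h ζ₁) :=
    indepSet_mono (matchedSet_subset (ends := ends) (h := h) ζ₁) hind
  have hhM : h ∉ matchedSet ends J h ζ₁ := fun h' => hhJ h'.1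
  have hunb : ∀ e p, ends e = s(u, p) → p ∉ matchedSet ends J h ζ₁ ∧ p ≠ u := by
    intro e p hep
    constructor
    · intro hpM
      exact hind e u huJ p hpM.1 hep
    · rintro rfl
      exact hind e p huJ p huJ hep
  have hf₁ : MFine ends (matchedSet ends J h ζ₁) h ζ₁ :=
    mfine_matchedSet2 hF hhJ hind hadj hout hζ₁
  have h1 := (matched_iff_matched_splitS hind' hhM huM hunb hf).1 hmη
  have h2 := (matched_iff_matched_splitS hind' hhM huM hunb hf₁).2 (hm h1)
  exact huM ⟨huJ, h2⟩

include hF hhJ hind hadj hout in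
/-- **The matched set is constant along the orbit** of the graph split at it. -/
theorem matchedSet_orbitReal2 {ζ₁ : Config E} (hζ₁ : ζ₁ ∈ swOutSide2 ends l h 𝓤₁ 𝓤₂ U ξ)
    (ω : Config (arms (splitEndsS ends (matchedSet ends J h ζ₁))
      (allRed (splitEndsS ends (matchedSet ends J h ζ₁)) ζ₁ (Sum.inl h)) (Sum.inl h))) :
    matchedSet ends J h (orbitReal (splitEndsS ends (matchedSet ends J h ζ₁))
      (allRed (splitEndsS ends (matchedSet ends J h ζ₁)) ζ₁ (Sum.inl h)) (Sum.inl h) ω) =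
      matchedSet ends J h ζ₁ := by
  have hind' : IndepSet ends (matchedSet ends J h ζ₁) :=
    indepSet_mono (matchedSet_subset (ends := ends) (h := h) ζ₁) hind
  have hc₁ : CoreFree (splitEndsS ends (matchedSet ends J h ζ₁)) ζ₁ (Sum.inl h) :=
    coreFree_split_matchedSet2 hF hhJ hind hout hζ₁
  have hf₁ : MFine ends (matchedSet ends J h ζ₁) h ζ₁ :=
    mfine_matchedSet2 hF hhJ hind hadj hout hζ₁
  have hc₀ : CoreFree (splitEndsS ends (matchedSet ends J h ζ₁))
      (allRed (splitEndsS ends (matchedSet ends J h ζ₁)) ζ₁ (Sum.inl h)) (Sum.inl h) :=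
    coreFree_allRed hc₁
  have hfη : MFine ends (matchedSet ends J h ζ₁) h
      (orbitReal (splitEndsS ends (matchedSet ends J h ζ₁))
        (allRed (splitEndsS ends (matchedSet ends J h ζ₁)) ζ₁ (Sum.inl h)) (Sum.inl h) ω) := by
    intro e he
    rw [hull_orbitReal hc₀, hull_allRed hc₁]
    exact hf₁ e he
  ext u
  constructor
  · rintro ⟨huJ, hmu⟩
    by_contra huM
    refine not_matched_of_flips2 hF hhJ hind hadj hout hζ₁ huJ huM hfη (fun hm => ?_) hmu
    have h1 := matched_of_matched_flip (coreFree_allRed hc₀) (armClosed_armsFalse_allRed hc₀ ω) hm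
    rw [allRed_idem hc₁] at h1
    exact matched_of_matched_flip hc₁ (armClosed_blueSide hc₁) h1
  · intro huM
    exact ⟨huM.1, matched_of_mfine hind' hfη huM⟩

end Orbit

/-! ## The multi-junction theorem on the asymmetric side -/

section Main

variable {F : V → Prop} (h𝓤₁ : IsUpperSet 𝓤₁) (h𝓤₂ : IsUpperSet 𝓤₂)
  (hF : ∀ x, F x → ∀ S ∈ 𝓤₁, x ∈ S)
  (hl : l ∉ U) (hloop_h : ∀ e, ends e ≠ s(h, h)) (hJU : J ⊆ U) (hhJ : h ∉ J)
  (hind : IndepSet ends J)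
  (hadj : ∀ u ∈ J, ∀ e (he : u ∈ ends e), Sym2.Mem.other he ≠ h →
    ∃ e', ends e' = s(Sym2.Mem.other he, h))
  (hout : ∀ x ∈ U, x ≠ h → x ∉ J →
    F x ∨ (∃ e y, ends e = s(x, y) ∧ y ∉ U) ∨ (∀ e, x ∉ ends e))

include h𝓤₁ h𝓤₂ hF hl hloop_h hJU hhJ hind hadj hout in
/-- **THE MULTI-JUNCTION THEOREM ON THE ASYMMETRIC SIDE**: the rigid counting inequality on
`T(𝓤₁, 𝓤₂)` of every class of a region with an independent set `J` of junctions (no loop at `h`,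
`h ∉ J`, every neighbour `p ≠ h` of a junction adjacent to `h`, every vertex of `U ∖ {h}` outside
`J` forced by `𝓤₁`, with an outside edge, or with no edge). -/
theorem rigidOK2_of_junctions {𝓔 : Set (Set E)} (h𝓔 : IsUpperSet 𝓔) :
    ((swOutSide2 ends l h 𝓤₁ 𝓤₂ U ξ).filter fun ζ => redEdges ends ζ h ∈ 𝓔).card ≤
      ((swOutSide2 ends l h 𝓤₁ 𝓤₂ U ξ).filter fun ζ => blueEdges ends ζ h ∈ 𝓔).card := by
  have hlJ : l ∉ J := fun h' => hl (hJU h')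
  let key : Config E → Set V × Config E := fun ζ =>
    (matchedSet ends J h ζ, allRed (splitEndsS ends (matchedSet ends J h ζ)) ζ (Sum.inl h))
  let S₀ : Finset (Set V × Config E) := (swOutSide2 ends l h 𝓤₁ 𝓤₂ U ξ).image key
  have hmap : ∀ (P : Config E → Prop) (ζ : Config E),
      ζ ∈ (swOutSide2 ends l h 𝓤₁ 𝓤₂ U ξ).filter P → key ζ ∈ S₀ :=
    fun P ζ hζ => Finset.mem_image_of_mem key (Finset.mem_filter.1 hζ).1
  rw [Finset.card_eq_sum_card_fiberwise (hmap _), Finset.card_eq_sum_card_fiberwise (hmap _)]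
  refine Finset.sum_le_sum fun k hk => ?_
  obtain ⟨ζ₁, hζ₁, rfl⟩ := Finset.mem_image.1 hk
  have hind' : IndepSet ends (matchedSet ends J h ζ₁) :=
    indepSet_mono (matchedSet_subset (ends := ends) (h := h) ζ₁) hind
  have hMU : matchedSet ends J h ζ₁ ⊆ U := fun u hu => hJU hu.1
  have hhM : h ∉ matchedSet ends J h ζ₁ := fun h' => hhJ h'.1
  have hlM : l ∉ matchedSet ends J h ζ₁ := fun h' => hlJ h'.1
  have hl' := inl_notMem_splitRegionS (V := V) (E := E) (U := U) hl
  have hloop' := splitEndsS_ne_loop_h (ends := ends) (S := matchedSet ends J h ζ₁) hloop_h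
  have hc₁ : CoreFree (splitEndsS ends (matchedSet ends J h ζ₁)) ζ₁ (Sum.inl h) :=
    coreFree_split_matchedSet2 hF hhJ hind hout hζ₁
  have hf₁ : MFine ends (matchedSet ends J h ζ₁) h ζ₁ :=
    mfine_matchedSet2 hF hhJ hind hadj hout hζ₁
  have hcl₁ : ζ₁ ∈ outClass (splitEndsS ends (matchedSet ends J h ζ₁)) (splitRegionS U)
      (Sum.inl h) ξ :=
    mem_outClass_splitS_of_mem hind' hMU (mem_swOutSide2.1 hζ₁).2
  have hc₀ : CoreFree (splitEndsS ends (matchedSet ends J h ζ₁))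
      (allRed (splitEndsS ends (matchedSet ends J h ζ₁)) ζ₁ (Sum.inl h)) (Sum.inl h) :=
    coreFree_allRed hc₁
  have hcl₀ : allRed (splitEndsS ends (matchedSet ends J h ζ₁)) ζ₁ (Sum.inl h) ∈
      outClass (splitEndsS ends (matchedSet ends J h ζ₁)) (splitRegionS U) (Sum.inl h) ξ :=
    allRed_mem_outClass hcl₁ hc₁
  have hfib : ∀ (P P' : Config E → Prop),
      (∀ ζ, MFine ends (matchedSet ends J h ζ₁) h ζ → (P ζ ↔ P' ζ)) →
      ((swOutSide2 ends l h 𝓤₁ 𝓤₂ U ξ).filter P).filter (fun ζ => key ζ = key ζ₁) =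
        (orbit (splitEndsS ends (matchedSet ends J h ζ₁))
          (allRed (splitEndsS ends (matchedSet ends J h ζ₁)) ζ₁ (Sum.inl h)) (Sum.inl h)).filter
          fun ζ' => ζ' ∈ tgtU2 (splitEndsS ends (matchedSet ends J h ζ₁)) (Sum.inl l) (Sum.inl h)
            (pullInl E 𝓤₁) (pullInl E 𝓤₂) ∧ P' ζ' := by
    intro P P' hPP'
    ext ζ'
    simp only [Finset.mem_filter, orbit, Finset.mem_image, Finset.mem_univ, true_and, key,
      Prod.mk.injEq]
    constructor
    · rintro ⟨⟨hζ', hP⟩, hMeq, hred⟩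
      rw [hMeq] at hred
      have hf' : MFine ends (matchedSet ends J h ζ₁) h ζ' := by
        rw [← hMeq]; exact mfine_matchedSet2 hF hhJ hind hadj hout hζ'
      have hc' : CoreFree (splitEndsS ends (matchedSet ends J h ζ₁)) ζ' (Sum.inl h) := by
        rw [← hMeq]; exact coreFree_split_matchedSet2 hF hhJ hind hout hζ'
      obtain ⟨ω, hω⟩ := exists_orbitReal_eq hc' hred
      exact ⟨⟨ω, hω⟩, mem_tgtU2_splitS_of_mem hind' hlM hf' (mem_swOutSide2.1 hζ').1,
        (hPP' ζ' hf').1 hP⟩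
    · rintro ⟨⟨ω, rfl⟩, hQ', hP'⟩
      have hf' : MFine ends (matchedSet ends J h ζ₁) h
          (orbitReal (splitEndsS ends (matchedSet ends J h ζ₁))
            (allRed (splitEndsS ends (matchedSet ends J h ζ₁)) ζ₁ (Sum.inl h)) (Sum.inl h) ω) := by
        intro e he
        rw [hull_orbitReal hc₀, hull_allRed hc₁]
        exact hf₁ e he
      have hcl' := orbitReal_mem_outClass hc₀ hcl₀ ω
      have hMeq := matchedSet_orbitReal2 hF hhJ hind hadj hout hζ₁ ω
      refine ⟨⟨mem_swOutSide2.2 ⟨mem_tgtU2_of_mem_splitS hind' hlM hf' hQ',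
        mem_outClass_of_mem_splitS hind' hMU hhM hf' hcl'⟩, (hPP' _ hf').2 hP'⟩, hMeq, ?_⟩
      rw [hMeq, allRed_orbitReal hc₀ ω, allRed_idem hc₁]
  rw [hfib _ (fun ζ' => redEdges (splitEndsS ends (matchedSet ends J h ζ₁)) ζ' (Sum.inl h) ∈ 𝓔)
      (fun ζ hf => by rw [redEdges_eq_of_mfine hind' hhM hf]),
    hfib _ (fun ζ' => blueEdges (splitEndsS ends (matchedSet ends J h ζ₁)) ζ' (Sum.inl h) ∈ 𝓔)
      (fun ζ hf => by rw [blueEdges_eq_of_mfine hind' hhM hf])]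
  exact card_orbit_le2 hc₀ hloop' (isUpperSet_pullInl h𝓤₁) (isUpperSet_pullInl h𝓤₂) hcl₀ hl' h𝓔

end Main

section Graph

variable {F : V → Prop}

/-- **The asymmetric domination on every graph with an independent set `J` of junctions** in the
region `{l}ᶜ` (`l, h ∉ J`, no loop at `h`, every neighbour `p ≠ h` of a junction adjacent to `h`,
every other vertex forced by `𝓤₁`, joined to `l`, or isolated), for every pair of up-sets. -/
theorem swAll2_of_junctions (hlh : l ≠ h) (hloop_h : ∀ e, ends e ≠ s(h, h)) (hlJ : l ∉ J)
    (hhJ : h ∉ J) (hind : IndepSet ends J)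
    (h𝓤₁ : IsUpperSet 𝓤₁) (h𝓤₂ : IsUpperSet 𝓤₂) (hF : ∀ x, F x → ∀ S ∈ 𝓤₁, x ∈ S)
    (hadj : ∀ u ∈ J, ∀ e (he : u ∈ ends e), Sym2.Mem.other he ≠ h →
      ∃ e', ends e' = s(Sym2.Mem.other he, h))
    (hout : ∀ x, x ≠ l → x ≠ h → x ∉ J →
      F x ∨ (∃ e, ends e = s(x, l)) ∨ (∀ e, x ∉ ends e)) :
    SwAll2 ends l h 𝓤₁ 𝓤₂ := by
  refine exists_swAll_injection_of_card_le h _ (card_le_asym_of_classes hlh fun ξ 𝓔 h𝓔 => ?_)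
  refine rigidOK2_of_junctions (ξ := ξ) (J := J) h𝓤₁ h𝓤₂ hF (by simp) hloop_h
    (fun u hu => by
      simp only [Set.mem_compl_iff, Set.mem_singleton_iff]
      rintro rfl
      exact hlJ hu) hhJ hind hadj ?_ h𝓔
  intro x hx hxh hxJ
  rcases hout x (by simpa using hx) hxh hxJ with hf | ⟨e, he⟩ | hiso
  · exact Or.inl hf
  · exact Or.inr (Or.inl ⟨e, l, he, by simp⟩)
  · exact Or.inr (Or.inr hiso)

end Graph

end LocRows

end Summit.Ventures.PercRepro2
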